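import Mathlib.Algebra.MvPolynomial.PDeriv
import Mathlib.Algebra.MvPolynomial.CommRing
import Mathlib.Data.Matrix.Mul
import Mathlib.Data.Finsupp.Weight
import HarnessLib

/-!
# The Hessian of a polynomial at the origin; the Mignon–Ressayre data for the permanent

Topic `Literature/Computability/AlgebraicComplexity`. Elementary formal-calculus vocabulary used
by the proof of the Mignon–Ressayre bound `dc(per_n) ≥ n² / 2`
(`PermanentVsDeterminantProofs.lean`, discharging
`sq_le_two_mul_determinantalComplexity_perPoly_complex` of `PermanentVsDeterminant.lean`).

## Contents

* `hess0 f` — the Hessian of `f : MvPolynomial σ k` at the origin, the matrix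
  `(∂_s ∂_t f)(0)` (`constantCoeff (pderiv s (pderiv t f))`), bundled as a `k`-linear map
  `MvPolynomial σ k →ₗ[k] Matrix σ σ k`; `linPart f` — the gradient at the origin `(∂_s f)(0)`;
  the product rule `hess0_mul`, `hess0_C_mul`, and `hess0 f = 0` for `totalDegree f ≤ 1`.
* `transl x` — the translation `f ↦ f(X + x)` (`aeval (X s + C (x s))`), a `k`-algebra
  endomorphism; `pderiv` commutes with it (`pderiv_transl`), `(transl x f)(0) = f(x)`
  (`constantCoeff_transl`), hence `hess0 (transl x f) = ((∂_s ∂_t f)(x))` (`hess0_transl`): the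
  Hessian at a point, without any analysis.
* `mrPoint k m` — the Mignon–Ressayre point `y₀` of the permanental hypersurface of size
  `m + 3`: all entries `1` except `y₀(0,0) = 1 - (m + 3) = -(m + 2)` (Landsberg 2017, §6.4.6;
  Mignon–Ressayre 2004, §3).
* `mrHess k m` — the pattern of the Hessian of `per_{m+3}` at `y₀` with the common factor `m!`
  removed (Landsberg 2017, (6.4.3): the block matrix with blocks `0`, `Q = (m+1)(J - 1)`, `R`):
  entry `((c,d),(a,b))` equal to `0` if `a = c` or `b = d`, to `m + 1` if `0 ∈ {a, b, c, d}`, and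
  to `-2` otherwise.

The size is written `m + 3` (`m : ℕ`) so that `0 : Fin (m + 3)` is available and no natural
subtraction occurs; the theorems `hess0 (transl y₀ per) = m! • mrHess`, `rank mrHess = (m+3)²`
and the bound itself are in `PermanentVsDeterminantProofs.lean`.

## References

* T. Mignon, N. Ressayre, *A quadratic bound for the determinant and permanent problem*,
  Int. Math. Res. Not. 2004, no. 79, 4241–4253, Thm. 1.1 and §§2–3 (key `MignonRessayre2004`).
* J. M. Landsberg, *Geometry and Complexity Theory*, CUP 2017, §6.4.5 (Prop. 6.4.5.1,
  Exercise 6.4.5.2) and §6.4.6 (the point `y₀`, Exercises 6.4.6.1–2, (6.4.3), Lemma 6.4.6.3,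
  Thm. 6.4.6.4) (key `LandsbergGCT2017`).

## Design notes

* Mathlib has `MvPolynomial.pderiv` (a `Derivation`) with `pderiv_mul`, `pderiv_X`,
  `coeff_pderiv`, but no Hessian / Taylor-coefficient vocabulary for `MvPolynomial`
  (searched `hessian`, `Hessian`: only manifold / analysis notions); `hess0` is the minimal
  algebraic substitute. Nothing here is specific to the permanent except the last section.
-/

noncomputable section

open MvPolynomial Matrix

namespace Literature.Computability.AlgebraicComplexity

section HessZero

variable {k : Type*} [CommRing k] {σ : Type*}

/-- The Hessian of a polynomial at the origin, `(∂_s ∂_t f)(0)`, as a `k`-linear map to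
matrices. [folklore] -/
def hess0 : MvPolynomial σ k →ₗ[k] Matrix σ σ k where
  toFun f := Matrix.of fun s t => constantCoeff (pderiv s (pderiv t f))
  map_add' f g := by
    ext s t
    simp only [map_add, Matrix.of_apply, Matrix.add_apply]
  map_smul' c f := by
    ext s t
    simp only [Derivation.map_smul, constantCoeff_smul, Matrix.of_apply, Matrix.smul_apply,
      RingHom.id_apply]

/-- Entries of the Hessian at the origin. [folklore] -/
theorem hess0_apply (f : MvPolynomial σ k) (s t : σ) :
    hess0 f s t = constantCoeff (pderiv s (pderiv t f)) := rfl

/-- The linear part of a polynomial at the origin: `(∂_s f)(0)`, the coefficient of `X s`.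
[folklore] -/
def linPart (f : MvPolynomial σ k) : σ → k := fun s => constantCoeff (pderiv s f)

/-- Entries of the linear part. [folklore] -/
theorem linPart_apply (f : MvPolynomial σ k) (s : σ) :
    linPart f s = constantCoeff (pderiv s f) := rfl

/-- Product rule for the Hessian at the origin:
`H(fg) = f(0) H(g) + g(0) H(f) + ∇f(0) ∇g(0)ᵀ + ∇g(0) ∇f(0)ᵀ`. [folklore] -/
theorem hess0_mul (f g : MvPolynomial σ k) :
    hess0 (f * g) = constantCoeff f • hess0 g + constantCoeff g • hess0 f +
      (vecMulVec (linPart f) (linPart g) + vecMulVec (linPart g) (linPart f)) := by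
  ext s t
  simp only [hess0_apply, Matrix.add_apply, Matrix.smul_apply, vecMulVec_apply, linPart_apply,
    smul_eq_mul, pderiv_mul, map_add, map_mul]
  ring

/-- `H(c • f) = c • H(f)` for a constant `c`. [folklore] -/
theorem hess0_C_mul (c : k) (f : MvPolynomial σ k) : hess0 (C c * f) = c • hess0 f := by
  rw [C_mul', map_smul]

/-- A polynomial of total degree `≤ 1` has zero Hessian. [folklore] -/
theorem hess0_eq_zero_of_totalDegree_le_one {f : MvPolynomial σ k} (hf : f.totalDegree ≤ 1) :
    hess0 f = 0 := by
  ext s t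
  have h1 : coeff (Finsupp.single s 1 + Finsupp.single t 1) f = 0 := by
    apply coeff_eq_zero_of_totalDegree_lt
    rw [← Finsupp.degree_apply, map_add, Finsupp.degree_single, Finsupp.degree_single]
    omega
  rw [hess0_apply, Matrix.zero_apply]
  show coeff 0 (pderiv s (pderiv t f)) = 0
  rw [coeff_pderiv, zero_add, coeff_pderiv, h1, zero_mul, zero_mul]

/-- The translation `f ↦ f(X + x)` by a point `x`, as a `k`-algebra endomorphism of the
polynomial ring. [folklore] -/
def transl (x : σ → k) : MvPolynomial σ k →ₐ[k] MvPolynomial σ k :=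
  aeval fun s => X s + C (x s)

/-- `transl x (X s) = X s + x s`. [folklore] -/
@[simp] theorem transl_X (x : σ → k) (s : σ) : transl x (X s) = X s + C (x s) :=
  aeval_X _ _

/-- `transl x` fixes constants. [folklore] -/
@[simp] theorem transl_C (x : σ → k) (c : k) : transl x (C c) = C c := by
  simp [transl]

/-- Partial derivatives commute with translations. [folklore] -/
theorem pderiv_transl (x : σ → k) (i : σ) (f : MvPolynomial σ k) :
    pderiv i (transl x f) = transl x (pderiv i f) := by
  classical
  induction f using MvPolynomial.induction_on with
  | C a => simp
  | add p q hp hq => simp only [map_add, hp, hq]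
  | mul_X p j hp =>
      simp only [map_mul, map_add, transl_X, pderiv_mul, pderiv_C, add_zero, hp, pderiv_X]
      congr 2
      by_cases h : j = i
      · subst h; simp
      · rw [Pi.single_eq_of_ne h, map_zero]

/-- The constant term of the translate is the value at the point: `f(X + x)(0) = f(x)`.
[folklore] -/
theorem constantCoeff_transl (x : σ → k) (f : MvPolynomial σ k) :
    constantCoeff (transl x f) = eval x f := by
  have h1 : constantCoeff (transl x f) = aeval (0 : σ → k) (transl x f) := by simp
  rw [h1, transl, ← AlgHom.comp_apply, comp_aeval]
  simp

/-- The Hessian of the translate at the origin is the Hessian at the point: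
`H(f(X + x))(0)_{st} = (∂_s ∂_t f)(x)`. [folklore] -/
theorem hess0_transl (x : σ → k) (f : MvPolynomial σ k) (s t : σ) :
    hess0 (transl x f) s t = eval x (pderiv s (pderiv t f)) := by
  rw [hess0_apply, pderiv_transl, pderiv_transl, constantCoeff_transl]

end HessZero

/-! ### The Mignon–Ressayre point and Hessian pattern -/

section MignonRessayreData

/-- The Mignon–Ressayre point of the permanental hypersurface of size `m + 3`: the all-ones
matrix with the `(0,0)` entry replaced by `1 - (m + 3) = -(m + 2)`, so that `per(y₀) = 0`
(Landsberg 2017, §6.4.6, the point `y₀`; Mignon–Ressayre 2004, §3). [cite: LandsbergGCT2017, §6.4.6] -/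
def mrPoint (k : Type*) [CommRing k] (m : ℕ) : Fin (m + 3) × Fin (m + 3) → k :=
  fun u => if u.1 = 0 ∧ u.2 = 0 then -((m : k) + 2) else 1

/-- Entries of the Mignon–Ressayre point. [cite: LandsbergGCT2017, §6.4.6] -/
theorem mrPoint_apply (k : Type*) [CommRing k] (m : ℕ) (u : Fin (m + 3) × Fin (m + 3)) :
    mrPoint k m u = if u.1 = 0 ∧ u.2 = 0 then -((m : k) + 2) else 1 := rfl

/-- The pattern matrix of the Hessian of `per_{m+3}` at the Mignon–Ressayre point, with the common
factor `m!` removed: the entry `((c,d),(a,b))` is `0` if `a = c` or `b = d`, `m + 1` if one of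
`a, b, c, d` is the index `0`, and `-2` otherwise (Landsberg 2017, (6.4.3): in block form
`[[0, Q, …, Q], [Q, 0, R, …, R], …]` with `Q = (m+1)(J - 1)` and `R` having `m + 1` in its first
row and column and `-2` elsewhere off the diagonal). [cite: LandsbergGCT2017, (6.4.3)] -/
def mrHess (k : Type*) [CommRing k] (m : ℕ) :
    Matrix (Fin (m + 3) × Fin (m + 3)) (Fin (m + 3) × Fin (m + 3)) k :=
  Matrix.of fun s t => if t.1 = s.1 ∨ t.2 = s.2 then 0
    else if s.1 = 0 ∨ s.2 = 0 ∨ t.1 = 0 ∨ t.2 = 0 then (m : k) + 1 else -2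

/-- Entries of the Hessian pattern matrix. [cite: LandsbergGCT2017, (6.4.3)] -/
theorem mrHess_apply (k : Type*) [CommRing k] (m : ℕ) (s t : Fin (m + 3) × Fin (m + 3)) :
    mrHess k m s t = if t.1 = s.1 ∨ t.2 = s.2 then 0
      else if s.1 = 0 ∨ s.2 = 0 ∨ t.1 = 0 ∨ t.2 = 0 then (m : k) + 1 else -2 := rfl

end MignonRessayreData

end Literature.Computability.AlgebraicComplexity
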